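import Literature.GroupTheory.CombinatorialGroupTheory.CyclicAmalgamMixedPairs
import Literature.GroupTheory.CombinatorialGroupTheory.FiniteAmalgamVirtuallyFree
import Literature.GroupTheory.CombinatorialGroupTheory.VirtuallyFreeConjugacyInfiniteOrder
import HarnessLib

/-!
# Hyperbolic elements of a cyclic amalgam of free groups: separation through the finite-factor quotient

Topic `Literature/GroupTheory/CombinatorialGroupTheory`; theorems only, continuing
`CyclicAmalgamMixedPairs.lean`.  J. L. Dyer, *Separating conjugates in amalgamated free products and
HNN extensions*, J. Austral. Math. Soc. (A) 29 (1980), proof of Thm. 4, p. 40: once a pair `x ≁ y` of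
`P = ∗_ℤ F(α_i)` with `x` CYCLICALLY REDUCED OF LENGTH `≥ 2` has been pushed to a finite-factor
quotient amalgam `P̄ = P_{M,N} = ∗_{ℤ/L} (F(α_i)/N_i)` with `π x ≁ π y` (*"We have shown that if
`x ≁_P y` then `π_{M,N}(x) ≁ π_{M,N}(y)` in `P_{M,N}`"*), the proof ends with *"The result now follows
from Theorem 1"* — the conjugacy separability of amalgams of FINITE groups, which Dyer takes from her
1979 theorem that free-by-finite groups are conjugacy separable.  This file performs exactly that last
step, for elements of INFINITE ORDER, over the tree's bricks:

* `FiniteAmalgam.exists_normal_finiteIndex_not_isConj_of_not_isOfFinOrder` — in an amalgam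
  `∗_H G_i` of finitely many FINITE groups (injective `φ_i`), an element of infinite order and an
  element not conjugate to it have non-conjugate images in some finite quotient: the amalgam has a
  FREE normal subgroup of finite index (`pushoutI_exists_isFreeGroup_normal_finiteIndex`, the tree's
  `FiniteAmalgamVirtuallyFree`: permutational product + freeness of subgroups meeting no conjugate of
  a factor), and elements of infinite order of free-by-finite groups are conjugacy distinguished
  (`VirtuallyFree.exists_normal_finiteIndex_not_isConj_of_not_isOfFinOrder`, the tree's
  `VirtuallyFreeConjugacyInfiniteOrder`, the infinite-order half of Dyer 1979);
* bookkeeping for the hyperbolic case (`CyclicAmalgamHyperbolicPairs`): `Amalgam.base_mul_of_eq_of_mul_base_iff`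
  / `Amalgam.base_mul_of_ne_of_mul_base` (a sliding equation `h · u = v · h'` between letters lives in
  ONE factor), `CyclicAmalgam.not_commute_conj_of_not_mem_range` (malnormality ⇒ `c_i` and
  `u c_i u⁻¹` do not commute for a letter `u ∉ ⟨c_i⟩`);
* `CyclicAmalgam.exists_normal_finiteIndex_not_isConj_of_map_not_isConj` — **the pull-back to
  `P`**: if `x` is conjugate to a cyclically reduced word of length `≥ 2` whose letters the
  synchronised quotient map `Π : P → P̄` (`exists_synced_quotientAmalgam`) keeps off the amalgamated
  subgroup, and `Π x ≁ Π y` in `P̄`, then `x̄ ≁ ȳ` in `P ⧸ N` for some normal `N` of finite index.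

What is NOT here: the word-combinatorial heart `x ≁_P y ⇒ π x ≁ π y` for two cyclically reduced
elements (Dyer's Case 3; the tree's `AmalgamConjugacyReduction` supplies its abstract form).  Universe
note: the finite-amalgam brick is universe-monomorphic, so the index type and the generators live in
`Type` here (the surface-group application is in `Type`).

## References

* J. L. Dyer, *Separating conjugates in amalgamated free products and HNN extensions*, J. Austral.
  Math. Soc. Ser. A 29 (1980) 35–51, Thm. 1 p. 36, proof of Thm. 4 p. 40. [Dyer1980]
-/

namespace Literature.GroupTheory.CombinatorialGroupTheory

open Monoid Monoid.PushoutI Function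

/-! ### Sliding equations, letter by letter (any amalgam) -/

namespace Amalgam

variable {ι : Type*} {G : ι → Type*} [∀ i, Group (G i)] {H : Type*} [Group H] {φ : ∀ i, H →* G i}

/-- The value in `PushoutI φ` of a letter list. -/
local notation3 "ℓπ[" ψ "] " l:max =>
  List.prod (List.map (fun x => Monoid.PushoutI.of (φ := ψ) (Sigma.fst x) (Sigma.snd x)) l)

/-- A sliding equation `h · u = v · h'` between letters of the SAME factor is an equation in that
factor. [cite: Dyer1980, (I) p.38] -/
theorem base_mul_of_eq_of_mul_base_iff (hφ : ∀ i, Function.Injective (φ i)) {i : ι} (a b : G i)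
    (h h' : H) : base φ h * of i a = of i b * base φ h' ↔ φ i h * a = b * φ i h' := by
  rw [← of_apply_eq_base φ i h, ← of_apply_eq_base φ i h', ← map_mul, ← map_mul]
  exact (of_injective hφ i).eq_iff

/-- A sliding equation between letters (off the base group) of DIFFERENT factors has no solution.
[cite: Dyer1980, (I) p.38] -/
theorem base_mul_of_ne_of_mul_base (hφ : ∀ i, Function.Injective (φ i)) {i j : ι} (hij : i ≠ j)
    {a : G i} {b : G j} (ha : a ∉ (φ i).range) (hb : b ∉ (φ j).range) (h h' : H) :
    base φ h * of i a ≠ of j b * base φ h' := by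
  intro e
  have e' : ℓπ[φ] [⟨i, a⟩] = base φ h⁻¹ * ℓπ[φ] [⟨j, b * φ j h'⟩] := by
    simp only [List.map_cons, List.map_nil, List.prod_cons, List.prod_nil, mul_one]
    rw [map_mul, of_apply_eq_base, ← e, map_inv, inv_mul_cancel_left]
  refine lprod_cons_ne_of_ne hφ hij (List.IsChain.singleton _) ?_ (List.IsChain.singleton _) ?_ h⁻¹ e'
  · simpa using ha
  · simpa using mul_not_mem_range hb 1 h'

end Amalgam

/-! ### The last step in an amalgam of finite groups -/

namespace FiniteAmalgam

/-- **Elements of infinite order of an amalgam of finite groups are conjugacy distinguished**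
(Dyer 1980 Thm. 1 for such elements, via "finite amalgams are free-by-finite" and the infinite-order
half of Dyer 1979): in `∗_H G_i` with finitely many finite factors, finite `H` and injective `φ_i`,
if `x` has infinite order and `y` is not conjugate to `x`, then the images of `x` and `y` in some
finite quotient are not conjugate. [cite: Dyer1980, Thm. 1 p.36] -/
theorem exists_normal_finiteIndex_not_isConj_of_not_isOfFinOrder {ι : Type} {G : ι → Type}
    [∀ i, Group (G i)] {H : Type} [Group H] {φ : ∀ i, H →* G i} [Finite ι] [Finite H]
    [∀ i, Finite (G i)] (hφ : ∀ i, Injective (φ i)) {x y : PushoutI φ} (hx : ¬ IsOfFinOrder x)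
    (hxy : ¬ IsConj x y) :
    ∃ (N : Subgroup (PushoutI φ)) (_ : N.Normal) (_ : N.FiniteIndex),
      ¬ IsConj (QuotientGroup.mk x : PushoutI φ ⧸ N) (QuotientGroup.mk y) := by
  obtain ⟨K, hKn, hKf, hKfree⟩ := pushoutI_exists_isFreeGroup_normal_finiteIndex hφ
  haveI := hKn
  haveI := hKf
  haveI := hKfree
  obtain ⟨N, hNn, hNf, hN⟩ :=
    VirtuallyFree.exists_normal_finiteIndex_not_isConj_of_not_isOfFinOrder K hx hxy
  exact ⟨N, hNn, hNf, hN⟩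

end FiniteAmalgam

/-! ### Pulling back to the cyclic amalgam of free groups -/

namespace CyclicAmalgam

variable {ι : Type} {α : ι → Type}

/-- The value in `PushoutI φ` of a letter list. -/
local notation3 "ℓπ[" ψ "] " l:max =>
  List.prod (List.map (fun x => Monoid.PushoutI.of (φ := ψ) (Sigma.fst x) (Sigma.snd x)) l)

/-! ### Malnormality (bookkeeping for the hyperbolic case) -/

/-- **Malnormality ⇒ `c_i` and `u c_i u⁻¹` do not commute** for a letter `u ∉ ⟨c_i⟩` (commuting
elements of a free group have a common root `t`; `t` normalises `⟨c_i⟩`, so `t ∈ ⟨c_i⟩` by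
malnormality, whence `u c_i u⁻¹ ∈ ⟨c_i⟩`, contradicting malnormality again).
[cite: Dyer1980, Thm. 10 p.48] -/
theorem not_commute_conj_of_not_mem_range (φ : ∀ i, Multiplicative ℤ →* FreeGroup (α i)) {i : ι}
    (hmal : ∀ g : FreeGroup (α i), g ∉ (φ i).range →
      ∀ c : Multiplicative ℤ, g * φ i c * g⁻¹ ∈ (φ i).range → c = 1)
    {u : FreeGroup (α i)} (hu : u ∉ (φ i).range) :
    φ i (Multiplicative.ofAdd 1) * (u * φ i (Multiplicative.ofAdd 1) * u⁻¹) ≠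
      (u * φ i (Multiplicative.ofAdd 1) * u⁻¹) * φ i (Multiplicative.ofAdd 1) := by
  intro hc
  have h1 : (Multiplicative.ofAdd (1 : ℤ)) ≠ 1 := by
    rw [Ne, ofAdd_eq_one]; exact one_ne_zero
  obtain ⟨t, htc, htu⟩ := FreeGroup.exists_mem_zpowers_of_commute (show Commute _ _ from hc)
  obtain ⟨p, hp⟩ := Subgroup.mem_zpowers_iff.mp htc
  -- `t` commutes with `c_i = t ^ p`, hence normalises `⟨c_i⟩`; malnormality puts `t` in `⟨c_i⟩`
  have ht : t ∈ (φ i).range := by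
    by_contra ht
    refine h1 (hmal t ht (Multiplicative.ofAdd 1) ⟨Multiplicative.ofAdd 1, ?_⟩)
    rw [← hp]
    group
  -- hence `u c_i u⁻¹ ∈ ⟨t⟩ ⊆ ⟨c_i⟩`, contradicting malnormality at `u`
  exact h1 (hmal u hu (Multiplicative.ofAdd 1) (Subgroup.zpowers_le.mpr ht htu))

/-- **Pull-back of Dyer's finite-amalgam step** (proof of Thm. 4, p. 40, last sentence): let
`Π : P = ∗_ℤ F(α_i) → P̄ = ∗_{ℤ/L} (F(α_i)/N_i)` be a synchronised finite-factor quotient map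
(letterwise, `N_i` of finite index, `ℤ/L ↪ F(α_i)/N_i` injective), `x` conjugate to a cyclically
reduced word `w` of length `≥ 2` whose letters are kept off `⟨c_i⟩ N_i`, and suppose `Π x ≁ Π y`
in `P̄`.  Then `x̄ ≁ ȳ` in `P ⧸ N` for some normal subgroup `N` of finite index.
[cite: Dyer1980, Thm. 4 proof p.40] -/
theorem exists_normal_finiteIndex_not_isConj_of_map_not_isConj [Finite ι]
    [∀ i, Finite (α i)] {φ : ∀ i, Multiplicative ℤ →* FreeGroup (α i)} {L : ℕ} [NeZero L]
    {N : ∀ i, Subgroup (FreeGroup (α i))} [∀ i, (N i).Normal] (hNf : ∀ i, (N i).FiniteIndex)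
    {φq : ∀ i, Multiplicative (ZMod L) →* FreeGroup (α i) ⧸ N i} (hφq_inj : ∀ i, Injective (φq i))
    {Pmap : PushoutI φ →* PushoutI φq}
    (hPof : ∀ i (g : FreeGroup (α i)),
      Pmap ((of (φ := φ) i : FreeGroup (α i) →* PushoutI φ) g) =
        (of (φ := φq) i : (FreeGroup (α i) ⧸ N i) →* PushoutI φq) (QuotientGroup.mk g))
    (hφq : ∀ i (n : ℤ), φq i (Multiplicative.ofAdd ((n : ℤ) : ZMod L)) =
      QuotientGroup.mk (φ i (Multiplicative.ofAdd n)))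
    {x y : PushoutI φ} {w : List (Σ i, FreeGroup (α i))} (hwc : w.IsChain fun a b => a.1 ≠ b.1)
    (hwN : ∀ z ∈ w, z.2 ∉ (((φ z.1).range ⊔ N z.1 : Subgroup (FreeGroup (α z.1))) :
      Set (FreeGroup (α z.1))))
    (hw2 : 2 ≤ w.length) (hwcr : ∀ a ∈ w.getLast?, ∀ b ∈ w.head?, a.1 ≠ b.1)
    (hx : ∃ p : PushoutI φ, p * x * p⁻¹ = ℓπ[φ] w) (hxy : ¬ IsConj (Pmap x) (Pmap y)) :
    ∃ (M : Subgroup (PushoutI φ)) (_ : M.Normal) (_ : M.FiniteIndex),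
      ¬ IsConj (QuotientGroup.mk x : PushoutI φ ⧸ M) (QuotientGroup.mk y) := by
  obtain ⟨p, hp⟩ := hx
  haveI : ∀ i, Finite (FreeGroup (α i) ⧸ N i) := fun i => by
    haveI := hNf i
    exact Subgroup.finite_quotient_of_finiteIndex
  -- `Π x` has infinite order: it is conjugate to the image of the cyclically reduced word
  have hxinf : ¬ IsOfFinOrder (Pmap x) := by
    intro hfin
    have h2 : IsOfFinOrder (Pmap (p * x * p⁻¹)) :=
      (Pmap.map_isConj (isConj_iff.mpr ⟨p, rfl⟩)).isOfFinOrder hfin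
    rw [hp] at h2
    exact not_isOfFinOrder_map_lprod hφq_inj hPof hφq hwc hwN hw2 hwcr h2
  -- separate in a finite quotient of `P̄` and pull back
  exact exists_normal_finiteIndex_not_isConj_of_monoidHom Pmap
    (FiniteAmalgam.exists_normal_finiteIndex_not_isConj_of_not_isOfFinOrder hφq_inj hxinf hxy)

end CyclicAmalgam

end Literature.GroupTheory.CombinatorialGroupTheory
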